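/-
Copyright: the b2b-balaban cell (near-miss cell 7), T⁴-continuum fan-out; row NE7b ROUND-2 swarm, seat
t4-ne7b-formalise-leaf-05 gen 2 (row S6g′(c) of `t4/b2b-balaban-t4-ne7b-p1/LEAVES-NE7b.md`, owner's ruling R-OWNER-22-12 (2)).
Released under the licence of the surrounding project.
-/
import Summits.QuantumFields.BalabanUV.T4Continuum.Support.HistorySiblingOrbits

/-!
# Sibling symmetry, part 4: SORTED REPRESENTATIVES — the canonical encoding pays the symmetry factor (row S6g′(c))

Summits-side support leaf of the T⁴-continuum cell (rung (B)+1 on a FINITE torus only; NOT infinite volume, NOT the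
mass gap, NOT the Clay statement; NOT a proof of the spine estimate NE7b).  Row NE7b, route «COUNT»; row S6g′(c), part
4 of `HistorySiblingSymmetry` ∕ `HistorySiblingOrbits`.  [folklore] finite combinatorics over abstract finite types;
nothing is quoted from print, nothing printed is asserted, no `[cite:]` tag, no `Prop` fact of Bałaban's.

WHY.  Part 2 counts the physical configurations of one join as ORBITS (`joinCount`).  For the RECURSION over the joins
of a member one wants plain finsets instead of quotients: the canonical encoding of a history lists the equal-shape
parts of a join in the order of their root cells, i.e. it produces SORTED labelled configurations — with the parts
linearly ordered (chain order) and a root read-out `ρ : Pos → R` into a linear order,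
`Sorted key ρ c := key i = key j → i < j → ρ (c i) < ρ (c j)`.  This file proves that sorted configurations are as
rare as orbits: **`#(A.filter Sorted) · |keyPerms key| ≤ #(A.filter RootInj)`** for every `keyPerms`-invariant `A`
(`card_sorted_mul_card_le`; the map `(c, σ) ↦ σ • c` is injective on sorted × group because a relabelling carrying a
sorted configuration to a sorted one is the identity — least-moved-part argument, `eq_one_of_sorted_smul`), hence with
parts 1–2 **`#(forestSet.filter Sorted) · ∏_k k_g! ≤ #forestSet ≤ (Σ_j B j)^{#parts−1}·∏_{i≠h} A i`**
(`card_sortedForest_mul_prod_factorial_le(_pow_mul)`).  In the recursion the placement space of a part is then the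
finset of its SORTED-canonical admissible internal configurations, and the total symmetry credit is `Σ_joins Σ_g log k!`.

WHAT.  §1 `RootInj`, `Sorted`, `Sorted.rootInj`, `RootInj.injOnFibres`, `rootInj_smul`, **`eq_one_of_sorted_smul`**.
§2 **`card_sorted_mul_card_le`**.  §3 `smul_mem_forestSet` (invariance of the hull alone) and the two END forms.

HONEST SCOPE.  Abstract finite types; the binding (parts of a join of an ordered shape tree, `ρ` = root cell, the
chain order on parts) is NOT here.  NE7b NOT proved.  HONEST DEPENDENCY (cell): continuum YM on T⁴ ⇐ BetaPertH ∧ nine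
spine estimates (0/9 proved); BetaPertH ⇐ (D1) ∧ (D4) ∧ CAP+tail.  This file changes none of it.
-/

open Finset
open Summit.QuantumFields.BalabanUV.T4Continuum.HistorySiblingSymmetry
open Summit.QuantumFields.BalabanUV.T4Continuum.HistorySiblingOrbits

namespace Summit.QuantumFields.BalabanUV.T4Continuum.HistorySiblingCanon

noncomputable section

/-! ## §1 Sorted and root-injective configurations; a sorted-to-sorted relabelling is the identity -/

section Sorted

variable {I K Pos R : Type*} (key : I → K) (ρ : Pos → R)

/-- ROOT-INJECTIVE: the parts of one shape class have distinct root read-outs. [folklore] -/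
def RootInj (c : I → Pos) : Prop := ∀ i j, key i = key j → ρ (c i) = ρ (c j) → i = j

variable {key ρ} in
/-- root-injective ⇒ fibre-injective [folklore] -/
theorem RootInj.injOnFibres {c : I → Pos} (h : RootInj key ρ c) : InjOnFibres key c :=
  fun i j hk heq => h i j hk (by rw [heq])

variable {key ρ} in
/-- root-injectivity is invariant under relabelling [folklore] -/
theorem rootInj_smul (σ : keyPerms key) {c : I → Pos} (hc : RootInj key ρ c) : RootInj key ρ (σ • c) := by
  intro i j hk heq
  rw [smul_apply, smul_apply] at heq
  have h := hc _ _ (by rw [key_symm_apply σ i, key_symm_apply σ j, hk]) heq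
  exact (σ : Equiv.Perm I).symm.injective h

variable [LinearOrder I] [LinearOrder R]

/-- SORTED: within each shape class the root read-outs increase along the order of the parts. [folklore] -/
def Sorted (c : I → Pos) : Prop := ∀ i j, key i = key j → i < j → ρ (c i) < ρ (c j)

variable {key ρ}

/-- sorted ⇒ root-injective [folklore] -/
theorem Sorted.rootInj {c : I → Pos} (h : Sorted key ρ c) : RootInj key ρ c := by
  intro i j hk heq
  rcases lt_trichotomy i j with hlt | heq' | hgt
  · exact absurd heq (h i j hk hlt).ne
  · exact heq'
  · exact absurd heq.symm (h j i hk.symm hgt).ne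

variable [Fintype I]

/-- **A RELABELLING CARRYING A SORTED CONFIGURATION TO A SORTED ONE IS THE IDENTITY** (least moved part: if it moves
down, its image is unmoved and injectivity fails; if it moves up, its preimage lies above it in the same class and the
two sorted inequalities collide). [folklore] -/
theorem eq_one_of_sorted_smul {σ : keyPerms key} {c : I → Pos} (hc : Sorted key ρ c) (hσ : Sorted key ρ (σ • c)) :
    σ = 1 := by
  classical
  set f : Equiv.Perm I := (σ : Equiv.Perm I).symm with hf
  have hkey : ∀ i, key (f i) = key i := fun i => key_symm_apply σ i
  have hval : ∀ i, (σ • c) i = c (f i) := fun i => rfl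
  suffices hfix : ∀ i, f i = i by
    apply Subtype.ext
    ext i
    have h1 := congrArg (σ : Equiv.Perm I) (hfix i)
    rw [hf, Equiv.apply_symm_apply] at h1
    exact h1.symm
  by_contra hne
  obtain ⟨i₁, hi₁⟩ : ∃ i, f i ≠ i := not_forall.1 hne
  -- the least moved part
  obtain ⟨i₀, hi₀, hmin⟩ : ∃ i₀, f i₀ ≠ i₀ ∧ ∀ j, f j ≠ j → i₀ ≤ j := by
    let S := (univ : Finset I).filter fun i => f i ≠ i
    have hS : S.Nonempty := by
      exact ⟨i₁, by simp [S, hi₁]⟩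
    refine ⟨S.min' hS, ?_, fun j hj => S.min'_le j (by simp [S, hj])⟩
    have hm := S.min'_mem hS
    simp only [S, mem_filter, mem_univ, true_and] at hm
    exact hm
  rcases lt_or_gt_of_ne hi₀ with hlt | hgt
  · -- moves down: the image is unmoved
    have hfix : f (f i₀) = f i₀ := by
      by_contra hne'
      exact absurd (hmin _ hne') (not_le.2 hlt)
    exact hi₀ (f.injective hfix)
  · -- moves up: the preimage lies above, same class; the two sorted inequalities collide
    set j := f.symm i₀ with hj
    have hfj : f j = i₀ := by rw [hj, Equiv.apply_symm_apply]
    have hj_ne : j ≠ i₀ := fun h => hi₀ (by rw [h] at hfj; exact hfj)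
    have hj_moved : f j ≠ j := by rw [hfj]; exact hj_ne.symm
    have hij : i₀ < j := lt_of_le_of_ne (hmin j hj_moved) hj_ne.symm
    have hk : key i₀ = key j := by rw [← hfj]; exact hkey j
    have h1 := hσ i₀ j hk hij
    rw [hval, hval, hfj] at h1
    have h2 := hc i₀ (f i₀) (hkey i₀).symm hgt
    exact lt_asymm h1 h2

end Sorted

/-! ## §2 Sorted configurations are as rare as orbits -/

section Count

variable {I K Pos R : Type*} [LinearOrder I] [Fintype I] [LinearOrder R] (key : I → K) (ρ : Pos → R)

open scoped Classical

/-- **`#(A.filter Sorted) · |keyPerms key| ≤ #(A.filter RootInj)`** for a `keyPerms`-invariant finset `A`: the map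
`(c, σ) ↦ σ • c` on sorted × group is injective (`eq_one_of_sorted_smul`) and lands in the root-injective members.
[folklore] -/
theorem card_sorted_mul_card_le (A : Finset (I → Pos)) (hA : ∀ (σ : keyPerms key) (c : I → Pos), c ∈ A → σ • c ∈ A) :
    (A.filter fun c => Sorted key ρ c).card * Fintype.card (keyPerms key) ≤
      (A.filter fun c => RootInj key ρ c).card := by
  rw [← card_univ, ← card_product]
  refine card_le_card_of_injOn (fun x => x.2 • x.1) (fun x hx => ?_) ?_
  · replace hx := Finset.mem_coe.1 hx
    rw [mem_product, mem_filter] at hx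
    obtain ⟨⟨hA1, hS⟩, -⟩ := hx
    exact Finset.mem_coe.2 (mem_filter.2 ⟨hA x.2 x.1 hA1, rootInj_smul x.2 hS.rootInj⟩)
  · rintro ⟨c, σ⟩ hx ⟨c', σ'⟩ hx' heq
    replace hx := Finset.mem_coe.1 hx
    replace hx' := Finset.mem_coe.1 hx'
    simp only [mem_product, mem_filter, mem_univ, and_true] at hx hx'
    simp only at heq
    -- `τ := σ'⁻¹ σ` carries the sorted `c` to the sorted `c'`
    have hτ : (σ'⁻¹ * σ) • c = c' := by rw [mul_smul, heq, inv_smul_smul]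
    have h1 : σ'⁻¹ * σ = 1 := eq_one_of_sorted_smul hx.2 (hτ ▸ hx'.2)
    have hσ : σ = σ' := by
      have := congrArg (σ' * ·) h1
      simpa [← mul_assoc] using this
    subst hσ
    rw [inv_mul_cancel, one_smul] at hτ
    subst hτ
    rfl

end Count

/-! ## §3 The END forms over the forest hull -/

section End

variable {I K Pos R : Type*} [LinearOrder I] [Fintype I] [Fintype K] [DecidableEq K] [LinearOrder R] [Fintype Pos]
  [DecidableEq Pos]
variable {key : I → K} {ρ : Pos → R} {ok : I → Pos → Prop} {touch : I → Pos → I → Pos → Prop} {h : I}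

open scoped Classical

omit [Fintype K] [DecidableEq K] [LinearOrder R] in
/-- **THE FOREST HULL IS `keyPerms`-INVARIANT** when the host is alone in its class and `ok`∕`touch` read the parts
through `key`. [folklore] -/
theorem smul_mem_forestSet (hkey : ∀ i, key i = key h → i = h) (hok : ∀ i j, key i = key j → ∀ p, (ok i p ↔ ok j p))
    (ht : ∀ i i' j j', key i = key i' → key j = key j' → ∀ p q, (touch i p j q ↔ touch i' p j' q)) (p₀ : Pos)
    (σ : keyPerms key) (c : I → Pos) (hc : c ∈ forestSet ok touch h p₀) : σ • c ∈ forestSet ok touch h p₀ := by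
  rw [smul_eq_comp]
  refine (mem_forestSet_comp_perm (σ : Equiv.Perm I).symm ?_ (fun i p => ?_) (fun i p j q => ?_) p₀ c).2 hc
  · exact hkey _ (key_symm_apply σ h)
  · exact hok _ _ (key_symm_apply σ i) p
  · exact ht _ _ _ _ (key_symm_apply σ i) (key_symm_apply σ j) p q

/-- **END (natural numbers): `#(forestSet.filter Sorted) · ∏_k k_g! ≤ ∏_{i ≠ h} Σ_j N i j`.** [folklore] -/
theorem card_sortedForest_mul_prod_factorial_le (hkey : ∀ i, key i = key h → i = h)
    (hok : ∀ i j, key i = key j → ∀ p, (ok i p ↔ ok j p))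
    (ht : ∀ i i' j j', key i = key i' → key j = key j' → ∀ p q, (touch i p j q ↔ touch i' p j' q)) (p₀ : Pos)
    (ρ : Pos → R) (N : I → I → ℕ)
    (hN : ∀ i, i ≠ h → ∀ j q, (univ.filter fun p : Pos => ok i p ∧ touch i p j q).card ≤ N i j) :
    ((forestSet ok touch h p₀).filter fun c => Sorted key ρ c).card * ∏ k, (Fintype.card {i // key i = k}).factorial ≤
      ∏ i : {i // i ≠ h}, ∑ j, N i.1 j := by
  rw [← card_keyPerms key]
  calc ((forestSet ok touch h p₀).filter fun c => Sorted key ρ c).card * Fintype.card (keyPerms key)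
      ≤ ((forestSet ok touch h p₀).filter fun c => RootInj key ρ c).card :=
        card_sorted_mul_card_le key ρ _ (smul_mem_forestSet hkey hok ht p₀)
    _ ≤ (forestSet ok touch h p₀).card := card_le_card (filter_subset _ _)
    _ ≤ ∏ i : {i // i ≠ h}, ∑ j, N i.1 j := card_forestSet_le N hN

/-- **END (real product form): `#(forestSet.filter Sorted) · ∏_k k_g! ≤ (Σ_j B j)^{#parts − 1} · ∏_{i ≠ h} A i`** under
`N i j ≤ A i · B j` — the per-join input of `HistorySiblingMassLayered.layer_cost_le` ∕ `HistorySiblingMass.step_cost_le`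
with the canonical (sorted) encoding. [folklore] -/
theorem card_sortedForest_mul_prod_factorial_le_pow_mul (hkey : ∀ i, key i = key h → i = h)
    (hok : ∀ i j, key i = key j → ∀ p, (ok i p ↔ ok j p))
    (ht : ∀ i i' j j', key i = key i' → key j = key j' → ∀ p q, (touch i p j q ↔ touch i' p j' q)) (p₀ : Pos)
    (ρ : Pos → R) (N : I → I → ℕ)
    (hN : ∀ i, i ≠ h → ∀ j q, (univ.filter fun p : Pos => ok i p ∧ touch i p j q).card ≤ N i j)
    (A B : I → ℝ) (hAB : ∀ i, i ≠ h → ∀ j, (N i j : ℝ) ≤ A i * B j) :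
    (((forestSet ok touch h p₀).filter fun c => Sorted key ρ c).card : ℝ) *
        ∏ k, ((Fintype.card {i // key i = k}).factorial : ℝ) ≤
      (∑ j, B j) ^ (Fintype.card I - 1) * ∏ i : {i // i ≠ h}, A i.1 := by
  have h1 : ((((forestSet ok touch h p₀).filter fun c => Sorted key ρ c).card *
      ∏ k, (Fintype.card {i // key i = k}).factorial : ℕ) : ℝ) ≤ ((forestSet ok touch h p₀).card : ℝ) := by
    rw [← card_keyPerms key]
    exact_mod_cast (card_sorted_mul_card_le key ρ _ (smul_mem_forestSet hkey hok ht p₀)).trans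
      (card_le_card (filter_subset _ _))
  push_cast at h1
  exact h1.trans (card_forestSet_le_pow_mul ok touch h p₀ N hN A B hAB)

end End

/-! ## §4 Sanity -/

namespace Sanity

/-- two parts of one class on `Fin 2`, read-out the identity on `ℕ`: `(0 ↦ 3, 1 ↦ 5)` is sorted, `(0 ↦ 5, 1 ↦ 3)`
is root-injective but not sorted -/
example : Sorted (I := Fin 2) (fun _ => (0 : ℕ)) (fun p : ℕ => p) ![3, 5] ∧
    ¬ Sorted (I := Fin 2) (fun _ => (0 : ℕ)) (fun p : ℕ => p) ![5, 3] := by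
  refine ⟨fun i j _ hij => ?_, fun h => ?_⟩
  · fin_cases i <;> fin_cases j <;> simp_all
  · have := h 0 1 rfl (by decide)
    simp at this

end Sanity

end

end Summit.QuantumFields.BalabanUV.T4Continuum.HistorySiblingCanon
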